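import Mathlib
import Summits.KontsevichZagierPeriods.Zeta5Search.PalindromeLemma
import Summits.KontsevichZagierPeriods.Zeta5Search.PalindromicClassBounds
import Summits.KontsevichZagierPeriods.Zeta5Search.UniversalDigitW
import Summits.KontsevichZagierPeriods.Zeta5Search.RecordCellADigitsA
import HarnessLib

/-!
# ζ(5) search — the PALINDROME BONUS for the ζ(3)-coefficient: `min(wLBpal, 1) ≤ v_p(W(b))` in the window

Cell `pub-zeta5` (HONEST FRAMING: systematic search; no irrationality claim unless certified), typer seat
generation 9.  Census g13's conjecture `PalindromicClassBoundW` (`Zeta5Search/PalindromicClassBounds.lean`: `wLBpal ≤ v_p(W)`,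
the tree rows `wLB` of typer g8 with gen-2 g6's `+1` palindrome bonus on multipole classes whose configuration is palindromic with
`3 + E_x` odd) is proved here in the form

* `min_wLBpal_one_le_padicValRat_coeffW : InPolytope b → p.Prime → 5 ≤ p → b₀+2 < p² → W(b) ≠ 0 → min (wLBpal b p) 1 ≤ v_p(W(b))`,

i.e. verbatim whenever `wLBpal ≤ 1` — in particular for every `(b,p)` at which the bonus changes a NEGATIVE bound, which is the
whole of census g13's ladder residue K∖M; the remaining case `wLBpal ≥ 2` (no single-pole class, `p ≤ d+1`, every multipole class
bound `≥ 2`) keeps the tree's `wLB ≥ 1` only.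

PROOF.  For a multipole class, `v(W_x) ≥ 3 + E_x` termwise (Theorem A), and for a palindromic class with `3 + E_x` odd the universal
digit `W_x = (−p)^{E_x+3}(ĝ_q ŵ_x + O(p))` (P1 g5's `CellA.wDigit`, gen-2 g9's U-W) has `ŵ_x = 0` (`wHat_eq_zero_of_palindromic`,
the palindrome lemma), so `v(W_x) ≥ 4 + E_x = classBound`; single-pole classes are `p`-integral (Theorem A′).  If `wLBpal ≤ 0` this
bounds `W = Σ_x W_x` classwise; if `wLBpal ≥ 1` every multipole class has `3 + E_x ≥ 1` and `p ≤ d+1`, so typer g8's residue route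
(`W = −𝒦_p`, `v(𝒦_x) ≥ 1`) gives `v(W) ≥ 1`.  `p`-adic valuations of rational numbers; nothing about irrationality.
-/

noncomputable section

open Finset

namespace Summit.KontsevichZagierPeriods.Zeta5Search.ClusterValuation

open Summit.KontsevichZagierPeriods.Zeta5Search.DualSeries (InBox)
open Summit.KontsevichZagierPeriods.Zeta5Search.WedgeDictionary (coeffW pfData dOf)
open Summit.KontsevichZagierPeriods.Zeta5Search.CasoratianValuation (InPolytope)
open Summit.KontsevichZagierPeriods.Zeta5Search.PadicSeries
open Summit.KontsevichZagierPeriods.Zeta5Search.CellA (classW coeffW_eq_sum_classW)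

variable {p : ℕ} [hp : Fact p.Prime]

/-! ### The class pieces `W_x = Σ_{q ∈ x} c_{2,q}` -/

omit hp in
/-- `W_x = 0` for a class without poles. -/
theorem classW_eq_zero_of_noPole (b : ℕ → ℤ) (hb : InPolytope b) {x : ℕ} (h0 : classPoleCount b p x = 0) :
    classW b p x = 0 :=
  sum_eq_zero fun q hq => pfData_eq_zero_of_netExp_nonneg b hb (le_of_mem_classSet b hq) (netExp_nonneg_of_noPole b h0 hq)
    (by norm_num)

/-- `W_x` is `p`-integral for a single-pole class (Theorem A′ termwise). -/
theorem padicNorm_classW_le_one (b : ℕ → ℤ) (hb : InPolytope b) (hp5 : 5 ≤ p) (hwin : (b 0 + 2 : ℤ) < (p : ℤ) ^ 2) {x : ℕ}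
    (hone : classPoleCount b p x = 1) : padicNorm p (classW b p x) ≤ 1 := by
  refine padicNorm.sum_le' (fun q hq => ?_) zero_le_one
  by_cases hz : pfData b 2 q = 0
  · rw [hz, padicNorm.zero]; exact zero_le_one
  have hcq : classPoleCount b p q = 1 := by unfold classPoleCount; rw [classSet_eq_of_mem hq]; exact hone
  have hv := isolatedPoleIntegral_holds b p q 2 hb hp.out (by omega) hwin (le_of_mem_classSet b hq)
    (by norm_num) hz hcq
  have h := padicNorm_le_of_val (p := p) (x := pfData b 2 q) (m := 0) (fun _ => hv)
  simpa using h

/-- **The multipole rows WITH the palindrome bonus**: `‖W_x‖_p ≤ p^{−classBound(x,3)}` for a class with at least two poles. -/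
theorem padicNorm_classW_le_classBound (b : ℕ → ℤ) (hb : InPolytope b) (hp5 : 5 ≤ p) (hwin : (b 0 + 2 : ℤ) < (p : ℤ) ^ 2)
    {x : ℕ} (hx : x < p) (hmulti : 2 ≤ classPoleCount b p x) :
    padicNorm p (classW b p x) ≤ (p : ℚ) ^ (-classBound b p x 3) := by
  have h0 : 0 ≤ b 0 := hb.1.1
  unfold classBound
  rw [if_pos hmulti]
  split_ifs with hpal
  · -- palindromic with `3 + E_x` odd: the universal digit vanishes
    obtain ⟨q, hq⟩ := card_pos.1 (by unfold classPoleCount at hmulti; omega :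
      0 < ((classSet b p x).filter fun s => netExp b s < 0).card)
    obtain ⟨hqC, hqpole⟩ := mem_filter.1 hq
    have hodd : Odd (3 + classExp b p x) := by simpa using hpal.2
    have hw0 : CellA.wHat b p x = 0 := by
      have e : CellA.wHat b p x = wHat b p x := rfl
      rw [e]; exact wHat_eq_zero_of_palindromic b h0 hpal.1 hodd
    have hdig := CellA.wDigit b p x q hb hp.out hp5 hwin hx hqC hqpole
    rw [hw0, mul_zero, sub_zero] at hdig
    refine padicNorm_le_of_val fun hne => ?_
    have := hdig hne
    unfold CellA.classW
    push_cast
    linarith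
  · -- Theorem A termwise
    refine padicNorm.sum_le' (fun q hq => ?_) (zpow_p_nonneg _)
    by_cases hz : pfData b 2 q = 0
    · rw [hz, padicNorm.zero]; exact zpow_p_nonneg _
    have hA := clusterBound_holds b p q 2 hb hp.out (by omega) hwin (le_of_mem_classSet b hq) (by norm_num) hz
    rw [classExp_eq_of_mem hq] at hA
    rw [padicNorm.eq_zpow_of_nonzero hz]
    exact zpow_le_zpow_right₀ one_le_p (by push_cast at hA ⊢; linarith)

/-! ### Readers of the palindromic row list -/

omit hp in
/-- A multipole class bounds `wLBpal` by its row. -/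
theorem wLBpal_le_classBound (b : ℕ → ℤ) {x : ℕ} (hx : x < p) (hmulti : 2 ≤ classPoleCount b p x) :
    wLBpal b p ≤ classBound b p x 3 := by
  unfold wLBpal
  refine getD_min_le (List.mem_append.2 (Or.inl ?_))
  unfold classRowListPal
  exact List.mem_filterMap.2 ⟨x, List.mem_range.2 hx, by rw [if_neg (by omega), if_pos hmulti]⟩

omit hp in
/-- Above the critical range the list carries a `0`. -/
theorem wLBpal_le_zero_of_lt (b : ℕ → ℤ) (h : dOf b + 1 < (p : ℤ)) : wLBpal b p ≤ 0 := by
  unfold wLBpal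
  exact getD_min_le (List.mem_append.2 (Or.inr (by rw [if_pos h]; simp)))

omit hp in
/-- A multipole row `≥ 1` forces `3 + E_x ≥ 1` (an odd `3 + E_x ≥ 0` is `≥ 1`). -/
theorem one_le_three_add_classExp (b : ℕ → ℤ) {x : ℕ} (hmulti : 2 ≤ classPoleCount b p x)
    (h1 : 1 ≤ classBound b p x 3) : 1 ≤ 3 + classExp b p x := by
  unfold classBound at h1
  rw [if_pos hmulti] at h1
  split_ifs at h1 with hpal
  · obtain ⟨k, hk⟩ := hpal.2
    push_cast at h1 hk
    omega
  · push_cast at h1; linarith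

/-! ### The bound -/

/-- **The palindrome bonus for `W` (census g13's `PalindromicClassBoundW`, in the form `min(wLBpal,1) ≤ v_p(W)`).** -/
theorem min_wLBpal_one_le_padicValRat_coeffW (b : ℕ → ℤ) (hb : InPolytope b) (hp5 : 5 ≤ p)
    (hwin : (b 0 + 2 : ℤ) < (p : ℤ) ^ 2) (hW : coeffW b ≠ 0) :
    min (wLBpal b p) 1 ≤ padicValRat p (coeffW b) := by
  set w := wLBpal b p with hw
  by_cases hwle : w ≤ 0
  · -- the classwise route `W = Σ_x W_x`
    rw [min_eq_left (by linarith)]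
    apply val_ge_of_padicNorm_le hW
    rw [coeffW_eq_sum_classW b hp.out.pos]
    refine padicNorm.sum_le' (fun x hx => ?_) (zpow_p_nonneg _)
    have hx' := mem_range.1 hx
    rcases Nat.lt_trichotomy (classPoleCount b p x) 1 with hc | hc | hc
    · rw [classW_eq_zero_of_noPole b hb (by omega), padicNorm.zero]; exact zpow_p_nonneg _
    · refine (padicNorm_classW_le_one b hb hp5 hwin hc).trans ?_
      rw [← zpow_zero (p : ℚ)]
      exact zpow_le_zpow_right₀ one_le_p (by linarith)
    · exact (padicNorm_classW_le_classBound b hb hp5 hwin hx' (by omega)).trans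
        (zpow_le_zpow_right₀ one_le_p (by linarith [wLBpal_le_classBound b hx' (by omega : 2 ≤ classPoleCount b p x)]))
  · -- `wLBpal ≥ 1`: the residue route with target `1`
    push Not at hwle
    rw [min_eq_right (by linarith)]
    have hpd : (p : ℤ) ≤ dOf b + 1 := by
      by_contra h
      push Not at h
      linarith [wLBpal_le_zero_of_lt b h]
    have hrowK : ∀ x ∈ range p, padicNorm p (classK b p x) ≤ (p : ℚ) ^ (-(1 : ℤ)) := by
      intro x hx
      have hx' := mem_range.1 hx
      rcases Nat.lt_trichotomy (classPoleCount b p x) 1 with hc | hc | hc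
      · rw [classK_eq_zero_of_noPole b hb (by omega), padicNorm.zero]; exact zpow_p_nonneg _
      · exact padicNorm_classK_le_single b hb hp5 hwin hx' hc
      · have h1 := one_le_three_add_classExp b (by omega : 2 ≤ classPoleCount b p x)
          (by linarith [wLBpal_le_classBound b hx' (by omega : 2 ≤ classPoleCount b p x)])
        exact (padicNorm_classK_le_multi b hb hp5 hwin hx' (by omega)).trans (zpow_le_zpow_right₀ one_le_p (by linarith))
    have hK : padicNorm p (kRes b p) ≤ (p : ℚ) ^ (-(1 : ℤ)) := by
      rw [kRes_eq_sum_classK b hp.out.pos]; exact padicNorm.sum_le' hrowK (zpow_p_nonneg _)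
    apply val_ge_of_padicNorm_le hW
    rw [coeffW_eq_omegaRes_sub_kRes b p, omegaRes_eq_zero b hb hpd, zero_sub, padicNorm.neg]
    exact hK

/-- **Corollary**: `PalindromicClassBoundW` holds at every `(b, p)` with `wLBpal(b,p) ≤ 1`. -/
theorem wLBpal_le_padicValRat_coeffW_of_le_one (b : ℕ → ℤ) (hb : InPolytope b) (hp5 : 5 ≤ p)
    (hwin : (b 0 + 2 : ℤ) < (p : ℤ) ^ 2) (hW : coeffW b ≠ 0) (hle : wLBpal b p ≤ 1) :
    wLBpal b p ≤ padicValRat p (coeffW b) := by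
  have h := min_wLBpal_one_le_padicValRat_coeffW b hb hp5 hwin hW
  rwa [min_eq_left hle] at h

end Summit.KontsevichZagierPeriods.Zeta5Search.ClusterValuation

end
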